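import Mathlib
import Summits.MatrixMultiplication.MatrixMultiplication.Theorems.SoloBlindTypeModelPrelim
import Summits.MatrixMultiplication.MatrixMultiplication.Theorems.SoloBlindTypePresence
import Summits.MatrixMultiplication.MatrixMultiplication.Theorems.SoloBlindTypeKill

/-!
# The type model: soundness of the per-family type oracle (solo-blind programme, K3.35 step 1e)

Setting: `G` a `ZMod 3`-module, `h : ι → G`, a block `B` on which `h` is linearly independent (and
sum-distinct), and `m` outside points `x : Fin m ↪ ι` avoiding `B`.  With `β` the basis of `G`
extending `h|_B` (`Basis.sumExtend`), every basis index `e` has a TYPE `t_e ∈ (ZMod 3)^{m+1}`: the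
`e`-coordinates of `h (x 0), …, h (x (m-1)), τ`.  Block indices give block slots `2 · code (t_e)`,
ambient indices give ambient slots `2 · code (t_e) + 1` of the oracle of `SoloBlindFamTables`.

MAIN THEOREM `soloBlind_typeModel`: if `h` is zero-sum free on `B ∪ X` (and, in mode E, `τ` is
H-good on `B ∪ X`) and the oracle accepts the exact presence family of `τ` (as bitmasks) at scale
`S`, then `mass(τ; B ∪ X) · 2^S ≤ 2^S` (resp. `≤ 2^(S-1)`); corollaries `soloBlind_typeModel_kraft`
(`mass ≤ 1`) and `soloBlind_typeModel_conjE` (`mass ≤ 1/2`).  Proof: the set of slots of all basis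
indices is a valid slot set for the oracle instance — usable at every member (presence in
coordinates, `soloBlind_repAll_nonempty_iff_coords`), hitting every constraint
(`soloBlind_noZeroSum_iff_hit` applied to the `zsf` / `H` hypotheses) — and its value dominates the
scaled mass (mass over bitmasks, sum-distinctness of the block, `soloBlind_repAll_card_eq`);
`soloBlindFamCheck_sound` bounds the value.
-/

namespace Summit.MatrixMultiplication.MatrixMultiplication.Theorems

open Finset Module

variable {G : Type*} [AddCommGroup G] [DecidableEq G] {ι : Type*} [DecidableEq ι]

/-! ## Types of basis indices -/

section Model

variable [Module (ZMod 3) G]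

omit [DecidableEq G] in
/-- In a `ZMod 3`-module every element has order dividing `3`. -/
theorem soloBlind_three_of_module (g : G) : g + g + g = 0 := by
  have h1 : ((1 : ZMod 3) + 1 + 1) • g = 0 := by
    rw [show ((1 : ZMod 3) + 1 + 1) = 0 from by decide, zero_smul]
  rwa [add_smul, add_smul, one_smul] at h1

/-- The TYPE of the basis index `e`: the `e`-coordinates of the entries of `v`. -/
noncomputable def soloBlindTy {h : ι → G} {B : Finset ι}
    (hli : LinearIndependent (ZMod 3) (fun i : B => h i)) {m : ℕ} (v : Fin (m + 1) → G)
    (e : B ⊕ Basis.sumExtendIndex hli) : Fin (m + 1) → ZMod 3 :=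
  fun a => (Basis.sumExtend hli).coord e (v a)

omit [DecidableEq G] [DecidableEq ι] in
/-- RESIDUE BRIDGE: the residue of the type code at `M` is the `e`-coordinate of the shifted target. -/
theorem soloBlind_resid_ty {h : ι → G} {B : Finset ι}
    (hli : LinearIndependent (ZMod 3) (fun i : B => h i)) {m : ℕ} (x : Fin m ↪ ι) (τ : G)
    (e : B ⊕ Basis.sumExtendIndex hli) (M : ℕ) :
    soloBlindResid m (soloBlindTyCode (soloBlindTy hli (soloBlindVec h x τ) e)) M =
      (Basis.sumExtend hli).coord e (τ - ∑ a ∈ soloBlindDecSet m M, h (x a)) := by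
  unfold soloBlindResid
  rw [map_sub, map_sum]
  have hl := soloBlindDig_tyCode (soloBlindTy hli (soloBlindVec h x τ) e) (Fin.last m)
  rw [Fin.val_last] at hl
  rw [hl]
  congr 1
  · simp [soloBlindTy, soloBlindVec_last]
  · refine Finset.sum_congr rfl fun a _ => ?_
    have ha := soloBlindDig_tyCode (soloBlindTy hli (soloBlindVec h x τ) e) a.castSucc
    rw [Fin.val_castSucc] at ha
    rw [ha]
    simp [soloBlindTy, soloBlindVec_castSucc]

omit [DecidableEq G] [DecidableEq ι] in
/-- SUM BRIDGE: the (τ-augmented) type sum at `M` is the `e`-coordinate of the corresponding element. -/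
theorem soloBlind_tsum_ty {h : ι → G} {B : Finset ι}
    (hli : LinearIndependent (ZMod 3) (fun i : B => h i)) {m : ℕ} (x : Fin m ↪ ι) (τ : G)
    (e : B ⊕ Basis.sumExtendIndex hli) (M : ℕ) (wt : Bool) :
    soloBlindTSum m (soloBlindTyCode (soloBlindTy hli (soloBlindVec h x τ) e)) M wt =
      (Basis.sumExtend hli).coord e
        ((∑ a ∈ soloBlindDecSet m M, h (x a)) + if wt then τ else 0) := by
  unfold soloBlindTSum
  rw [map_add, map_sum]
  congr 1
  · refine Finset.sum_congr rfl fun a _ => ?_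
    have ha := soloBlindDig_tyCode (soloBlindTy hli (soloBlindVec h x τ) e) a.castSucc
    rw [Fin.val_castSucc] at ha
    rw [ha]
    simp [soloBlindTy, soloBlindVec_castSucc]
  · have hl := soloBlindDig_tyCode (soloBlindTy hli (soloBlindVec h x τ) e) (Fin.last m)
    rw [Fin.val_last] at hl
    cases wt
    · simp
    · simp [hl, soloBlindTy, soloBlindVec_last]

/-- The slot set of the model: block slots `2·code(t_i)` and ambient slots `2·code(t_j)+1`. -/
noncomputable def soloBlindSlotSet {h : ι → G} {B : Finset ι}
    (hli : LinearIndependent (ZMod 3) (fun i : B => h i)) {m : ℕ} (v : Fin (m + 1) → G) : Finset ℕ :=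
  open Classical in
  (Finset.univ.image fun i : B => 2 * soloBlindTyCode (soloBlindTy hli v (Sum.inl i))) ∪
    ((Finset.univ : Finset (Fin (3 ^ (m + 1)))).filter fun c : Fin (3 ^ (m + 1)) =>
      ∃ j : Basis.sumExtendIndex hli, soloBlindTyCode (soloBlindTy hli v (Sum.inr j)) = (c : ℕ)).image
      fun c : Fin (3 ^ (m + 1)) => 2 * (c : ℕ) + 1

omit [DecidableEq G] [DecidableEq ι] in
/-- Block slots belong to the slot set. -/
theorem soloBlind_mem_slotSet_inl {h : ι → G} {B : Finset ι}
    (hli : LinearIndependent (ZMod 3) (fun i : B => h i)) {m : ℕ} (v : Fin (m + 1) → G) (i : B) :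
    2 * soloBlindTyCode (soloBlindTy hli v (Sum.inl i)) ∈ soloBlindSlotSet hli v := by
  unfold soloBlindSlotSet
  exact Finset.mem_union_left _ (Finset.mem_image.mpr ⟨i, Finset.mem_univ _, rfl⟩)

omit [DecidableEq G] [DecidableEq ι] in
/-- Ambient slots belong to the slot set. -/
theorem soloBlind_mem_slotSet_inr {h : ι → G} {B : Finset ι}
    (hli : LinearIndependent (ZMod 3) (fun i : B => h i)) {m : ℕ} (v : Fin (m + 1) → G)
    (j : Basis.sumExtendIndex hli) :
    2 * soloBlindTyCode (soloBlindTy hli v (Sum.inr j)) + 1 ∈ soloBlindSlotSet hli v := by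
  classical
  unfold soloBlindSlotSet
  rw [Finset.mem_union, Finset.mem_image, Finset.mem_image]
  refine Or.inr ⟨⟨soloBlindTyCode (soloBlindTy hli v (Sum.inr j)), soloBlindTyCode_lt _⟩, ?_, rfl⟩
  exact Finset.mem_filter.mpr ⟨Finset.mem_univ _, j, rfl⟩

omit [DecidableEq G] [DecidableEq ι] in
/-- Every slot of the slot set is a block slot or an ambient slot of some basis index. -/
theorem soloBlind_mem_slotSet_cases {h : ι → G} {B : Finset ι}
    (hli : LinearIndependent (ZMod 3) (fun i : B => h i)) {m : ℕ} (v : Fin (m + 1) → G) {k : ℕ}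
    (hk : k ∈ soloBlindSlotSet hli v) :
    (∃ i : B, k = 2 * soloBlindTyCode (soloBlindTy hli v (Sum.inl i))) ∨
      ∃ j : Basis.sumExtendIndex hli, k = 2 * soloBlindTyCode (soloBlindTy hli v (Sum.inr j)) + 1 := by
  classical
  unfold soloBlindSlotSet at hk
  rw [Finset.mem_union, Finset.mem_image, Finset.mem_image] at hk
  rcases hk with ⟨i, -, rfl⟩ | ⟨c, hc, rfl⟩
  · exact Or.inl ⟨i, rfl⟩
  · rw [Finset.mem_filter] at hc
    obtain ⟨-, j, hj⟩ := hc
    exact Or.inr ⟨j, by rw [hj]⟩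

omit [DecidableEq G] [DecidableEq ι] in
/-- Slots are below `2 · 3^(m+1)`. -/
theorem soloBlind_slotSet_lt {h : ι → G} {B : Finset ι}
    (hli : LinearIndependent (ZMod 3) (fun i : B => h i)) {m : ℕ} (v : Fin (m + 1) → G) {k : ℕ}
    (hk : k ∈ soloBlindSlotSet hli v) : k < 2 * 3 ^ (m + 1) := by
  rcases soloBlind_mem_slotSet_cases hli v hk with ⟨i, rfl⟩ | ⟨j, rfl⟩
  · have := soloBlindTyCode_lt (soloBlindTy hli v (Sum.inl i)); omega
  · have := soloBlindTyCode_lt (soloBlindTy hli v (Sum.inr j)); omega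

/-- USABILITY: every slot is usable at every present bitmask. -/
theorem soloBlind_slotSet_ok {h : ι → G} {B : Finset ι}
    (hli : LinearIndependent (ZMod 3) (fun i : B => h i)) {m : ℕ} (x : Fin m ↪ ι) (τ : G) {k : ℕ}
    (hk : k ∈ soloBlindSlotSet hli (soloBlindVec h x τ)) {M : ℕ} (hM : M ∈ soloBlindExactFam h B x τ) :
    soloBlindOkSpec m k M = true := by
  obtain ⟨-, hpres⟩ := soloBlind_mem_exactFam.mp hM
  obtain ⟨hamb, hblk⟩ := (soloBlind_repAll_nonempty_iff_coords h B hli _).mp hpres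
  rcases soloBlind_mem_slotSet_cases hli _ hk with ⟨i, rfl⟩ | ⟨j, rfl⟩
  · rw [soloBlind_okSpec_block, decide_eq_true_eq, soloBlind_resid_ty]
    rcases hblk i with h0 | h1
    · rw [h0]; decide
    · rw [h1]; decide
  · rw [soloBlind_okSpec_amb, decide_eq_true_eq, soloBlind_resid_ty]
    exact hamb j

/-- COUNTING: at a present bitmask, the counting slots inject into the `1`-coordinates of the
shifted target, whose number is the size of its (unique) representation. -/
theorem soloBlind_slotSet_count_le {h : ι → G} {B : Finset ι}
    (hli : LinearIndependent (ZMod 3) (fun i : B => h i)) {m : ℕ} (x : Fin m ↪ ι) (τ : G) (M : ℕ)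
    {A : Finset ι} (hA : A ∈ soloBlindSeqRepAll h B (τ - ∑ a ∈ soloBlindDecSet m M, h (x a))) :
    ((soloBlindSlotSet hli (soloBlindVec h x τ)).filter fun k => soloBlindR1Spec m k M = true).card ≤
      A.card := by
  rw [soloBlind_repAll_card_eq h B hli hA]
  calc ((soloBlindSlotSet hli (soloBlindVec h x τ)).filter fun k => soloBlindR1Spec m k M = true).card
      ≤ ((Finset.univ.filter fun i : B => (Basis.sumExtend hli).coord (Sum.inl i)
            (τ - ∑ a ∈ soloBlindDecSet m M, h (x a)) = 1).image
          fun i : B => 2 * soloBlindTyCode (soloBlindTy hli (soloBlindVec h x τ) (Sum.inl i))).card := by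
        refine Finset.card_le_card fun k hk => ?_
        rw [Finset.mem_filter] at hk
        obtain ⟨hkW, hr1⟩ := hk
        obtain ⟨hpar, hres⟩ := soloBlind_r1Spec_true hr1
        rcases soloBlind_mem_slotSet_cases hli _ hkW with ⟨i, rfl⟩ | ⟨j, rfl⟩
        · refine Finset.mem_image.mpr ⟨i, Finset.mem_filter.mpr ⟨Finset.mem_univ _, ?_⟩, rfl⟩
          rw [show 2 * soloBlindTyCode (soloBlindTy hli (soloBlindVec h x τ) (Sum.inl i)) / 2 =
            soloBlindTyCode (soloBlindTy hli (soloBlindVec h x τ) (Sum.inl i)) by omega,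
            soloBlind_resid_ty] at hres
          exact hres
        · exfalso; omega
    _ ≤ _ := Finset.card_image_le

/-- PER-MASK BOUND: the block mass of the shifted target is at most `2^{-count}`. -/
theorem soloBlind_mask_mass_le {h : ι → G} {B : Finset ι}
    (hli : LinearIndependent (ZMod 3) (fun i : B => h i))
    (hdist : ∀ A ⊆ B, ∀ A' ⊆ B, ∑ i ∈ A, h i = ∑ i ∈ A', h i → A = A')
    {m : ℕ} (x : Fin m ↪ ι) (τ : G) (M : ℕ) :
    soloBlindMass h B (τ - ∑ a ∈ soloBlindDecSet m M, h (x a)) ≤ (1 / 2 : ℚ) ^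
      ((soloBlindSlotSet hli (soloBlindVec h x τ)).filter fun k => soloBlindR1Spec m k M = true).card :=
  soloBlind_mass_le_pow_of_card_le_one h B _ _ (soloBlind_repAll_card_le_one_of_sumDistinct hdist _)
    (fun _ hA => soloBlind_slotSet_count_le hli x τ M hA)

omit [DecidableEq G] in
/-- HITTING: every constraint of the oracle instance is hit by some slot. -/
theorem soloBlind_slotSet_hit {h : ι → G} {B : Finset ι}
    (hli : LinearIndependent (ZMod 3) (fun i : B => h i)) {m : ℕ} (x : Fin m ↪ ι)
    (hxB : ∀ a, x a ∉ B) (τ : G) (modeE : Bool)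
    (zsf : ∀ T ⊆ B ∪ Finset.univ.map x, T.Nonempty → ∑ i ∈ T, h i ≠ 0)
    (hgood : modeE = true → ∀ T ⊆ B ∪ Finset.univ.map x, ∑ i ∈ T, h i ≠ τ + τ)
    {c : ℕ} (hc : c < soloBlindNCons m modeE) :
    ∃ k ∈ soloBlindSlotSet hli (soloBlindVec h x τ), soloBlindHitSpec m k c = true := by
  unfold soloBlindNCons at hc
  by_cases hcm : c + 1 < 2 ^ m
  · -- a `zsf` constraint: `T = c + 1`
    have hne : (soloBlindDecSet m (c + 1)).Nonempty := soloBlindDecSet_nonempty (by omega) hcm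
    have hwA : ∀ A : Finset B, (∑ a ∈ soloBlindDecSet m (c + 1), h (x a)) + ∑ i ∈ A, h (i : ι) ≠ 0 := by
      intro A
      obtain ⟨hsub, hsum⟩ := soloBlind_outside_block_sum h x hxB (soloBlindDecSet m (c + 1)) A
      rw [← hsum]
      exact zsf _ hsub ((hne.map).mono Finset.subset_union_left)
    rcases (soloBlind_noZeroSum_iff_hit h B hli _).mp hwA with ⟨i, hi⟩ | ⟨j, hj⟩
    · refine ⟨_, soloBlind_mem_slotSet_inl hli _ i, ?_⟩
      rw [soloBlind_hitSpec_block_lo _ hcm, decide_eq_true_eq, soloBlind_tsum_ty]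
      simp only [Bool.false_eq_true, if_false, add_zero]
      exact hi
    · refine ⟨_, soloBlind_mem_slotSet_inr hli _ j, ?_⟩
      rw [soloBlind_hitSpec_amb_lo _ hcm, decide_eq_true_eq, soloBlind_tsum_ty]
      simp only [Bool.false_eq_true, if_false, add_zero]
      exact hj
  · -- an `H` constraint (mode E only): `T = c + 1 - 2^m`
    cases modeE
    · exfalso
      simp only [Bool.false_eq_true, if_false] at hc
      omega
    · simp only [if_true] at hc
      have three := soloBlind_three_of_module (G := G)
      have hwA : ∀ A : Finset B,
          (∑ a ∈ soloBlindDecSet m (c + 1 - 2 ^ m), h (x a)) + τ + ∑ i ∈ A, h (i : ι) ≠ 0 := by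
        intro A heq
        obtain ⟨hsub, hsum⟩ := soloBlind_outside_block_sum h x hxB (soloBlindDecSet m (c + 1 - 2 ^ m)) A
        refine hgood rfl _ hsub ?_
        rw [hsum]
        have e1 : (∑ a ∈ soloBlindDecSet m (c + 1 - 2 ^ m), h (x a)) + ∑ i ∈ A, h (i : ι) = -τ := by
          rw [eq_neg_iff_add_eq_zero, ← heq]
          abel
        rw [e1, neg_eq_iff_add_eq_zero, ← add_assoc, three]
      rcases (soloBlind_noZeroSum_iff_hit h B hli _).mp hwA with ⟨i, hi⟩ | ⟨j, hj⟩
      · refine ⟨_, soloBlind_mem_slotSet_inl hli _ i, ?_⟩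
        rw [soloBlind_hitSpec_block_hi _ hcm, decide_eq_true_eq, soloBlind_tsum_ty]
        simp only [if_true]
        exact hi
      · refine ⟨_, soloBlind_mem_slotSet_inr hli _ j, ?_⟩
        rw [soloBlind_hitSpec_amb_hi _ hcm, decide_eq_true_eq, soloBlind_tsum_ty]
        simp only [if_true]
        exact hj

/-- THE TYPE MODEL (soundness of the per-family oracle): if the oracle accepts the exact presence
family of `τ` over the outside points, the scaled mass obeys the oracle's bound. -/
theorem soloBlind_typeModel {h : ι → G} {B : Finset ι}
    (hli : LinearIndependent (ZMod 3) (fun i : B => h i))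
    (hdist : ∀ A ⊆ B, ∀ A' ⊆ B, ∑ i ∈ A, h i = ∑ i ∈ A', h i → A = A')
    {m : ℕ} (x : Fin m ↪ ι) (hxB : ∀ a, x a ∉ B) (τ : G) (modeE : Bool) (S : ℕ)
    (zsf : ∀ T ⊆ B ∪ Finset.univ.map x, T.Nonempty → ∑ i ∈ T, h i ≠ 0)
    (hgood : modeE = true → ∀ T ⊆ B ∪ Finset.univ.map x, ∑ i ∈ T, h i ≠ τ + τ)
    (hcheck : soloBlindFamCheck (soloBlindMkTabs m) m S (soloBlindExactFam h B x τ) modeE = true) :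
    soloBlindMass h (B ∪ Finset.univ.map x) τ * 2 ^ S ≤
      ((if modeE then 2 ^ (S - 1) else 2 ^ S : ℕ) : ℚ) := by
  set V := soloBlindSlotSet hli (soloBlindVec h x τ) with hV
  have hF : ∀ M ∈ soloBlindExactFam h B x τ, M < 2 ^ m := fun M hM => (soloBlind_mem_exactFam.mp hM).1
  have hs := soloBlindFamCheck_sound hF hcheck V (fun k hk => soloBlind_slotSet_lt hli _ hk)
    (fun k hk M hM => soloBlind_slotSet_ok hli x τ hk hM)
    (fun c hc => soloBlind_slotSet_hit hli x hxB τ modeE zsf hgood hc)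
  have hnodup : (soloBlindExactFam h B x τ).Nodup := List.nodup_range.filter _
  -- the mass lives on the exact family
  have hmass : soloBlindMass h (B ∪ Finset.univ.map x) τ =
      ∑ M ∈ (soloBlindExactFam h B x τ).toFinset, (1 / 2 : ℚ) ^ (soloBlindDecSet m M).card *
        soloBlindMass h B (τ - ∑ a ∈ soloBlindDecSet m M, h (x a)) := by
    rw [soloBlind_mass_eq_sum_masks h B x hxB τ]
    symm
    apply Finset.sum_subset
    · intro M hM
      rw [List.mem_toFinset, soloBlind_mem_exactFam] at hM
      exact Finset.mem_range.mpr hM.1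
    · intro M hM hMn
      rw [List.mem_toFinset, soloBlind_mem_exactFam, not_and] at hMn
      have habs := hMn (Finset.mem_range.mp hM)
      rw [Finset.not_nonempty_iff_eq_empty] at habs
      rw [soloBlind_mass_eq_zero_of_repAll_eq_empty habs, mul_zero]
  have hcast : (((soloBlindExactFam h B x τ).map fun M => soloBlindPow2T S ((soloBlindDecSet m M).card +
      (V.filter fun k => soloBlindR1Spec m k M = true).card)).sum : ℚ) =
      ∑ M ∈ (soloBlindExactFam h B x τ).toFinset, (soloBlindPow2T S ((soloBlindDecSet m M).card +
        (V.filter fun k => soloBlindR1Spec m k M = true).card) : ℚ) := by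
    rw [List.sum_toFinset _ hnodup, Nat.cast_list_sum, List.map_map]
    rfl
  calc soloBlindMass h (B ∪ Finset.univ.map x) τ * 2 ^ S
      = ∑ M ∈ (soloBlindExactFam h B x τ).toFinset, (1 / 2 : ℚ) ^ (soloBlindDecSet m M).card *
          soloBlindMass h B (τ - ∑ a ∈ soloBlindDecSet m M, h (x a)) * 2 ^ S := by
        rw [hmass, Finset.sum_mul]
    _ ≤ ∑ M ∈ (soloBlindExactFam h B x τ).toFinset, (soloBlindPow2T S ((soloBlindDecSet m M).card +
          (V.filter fun k => soloBlindR1Spec m k M = true).card) : ℚ) := by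
        refine Finset.sum_le_sum fun M _ => ?_
        calc (1 / 2 : ℚ) ^ (soloBlindDecSet m M).card *
              soloBlindMass h B (τ - ∑ a ∈ soloBlindDecSet m M, h (x a)) * 2 ^ S
            ≤ (1 / 2 : ℚ) ^ (soloBlindDecSet m M).card * (1 / 2 : ℚ) ^
                (V.filter fun k => soloBlindR1Spec m k M = true).card * 2 ^ S := by
              gcongr
              exact soloBlind_mask_mass_le hli hdist x τ M
          _ = (1 / 2 : ℚ) ^ ((soloBlindDecSet m M).card +
                (V.filter fun k => soloBlindR1Spec m k M = true).card) * 2 ^ S := by rw [pow_add]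
          _ ≤ _ := soloBlind_halfPow_mul_le S _
    _ = _ := hcast.symm
    _ ≤ _ := by exact_mod_cast hs

/-- THE TYPE MODEL, (K₃) form: oracle acceptance in mode K gives `mass(τ; B ∪ X) ≤ 1`. -/
theorem soloBlind_typeModel_kraft {h : ι → G} {B : Finset ι}
    (hli : LinearIndependent (ZMod 3) (fun i : B => h i))
    (hdist : ∀ A ⊆ B, ∀ A' ⊆ B, ∑ i ∈ A, h i = ∑ i ∈ A', h i → A = A')
    {m : ℕ} (x : Fin m ↪ ι) (hxB : ∀ a, x a ∉ B) (τ : G) (S : ℕ)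
    (zsf : ∀ T ⊆ B ∪ Finset.univ.map x, T.Nonempty → ∑ i ∈ T, h i ≠ 0)
    (hcheck : soloBlindFamCheck (soloBlindMkTabs m) m S (soloBlindExactFam h B x τ) false = true) :
    soloBlindMass h (B ∪ Finset.univ.map x) τ ≤ 1 := by
  have e := soloBlind_typeModel hli hdist x hxB τ false S zsf (fun hf => absurd hf Bool.false_ne_true)
    hcheck
  simp only [Bool.false_eq_true, if_false] at e
  push_cast at e
  exact le_of_mul_le_mul_right (by rwa [one_mul]) (pow_pos two_pos S)

/-- THE TYPE MODEL, Conjecture E form: oracle acceptance in mode E (with `S ≥ 1`) gives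
`mass(τ; B ∪ X) ≤ 1/2`. -/
theorem soloBlind_typeModel_conjE {h : ι → G} {B : Finset ι}
    (hli : LinearIndependent (ZMod 3) (fun i : B => h i))
    (hdist : ∀ A ⊆ B, ∀ A' ⊆ B, ∑ i ∈ A, h i = ∑ i ∈ A', h i → A = A')
    {m : ℕ} (x : Fin m ↪ ι) (hxB : ∀ a, x a ∉ B) (τ : G) {S : ℕ} (hS : 1 ≤ S)
    (zsf : ∀ T ⊆ B ∪ Finset.univ.map x, T.Nonempty → ∑ i ∈ T, h i ≠ 0)
    (hgood : ∀ T ⊆ B ∪ Finset.univ.map x, ∑ i ∈ T, h i ≠ τ + τ)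
    (hcheck : soloBlindFamCheck (soloBlindMkTabs m) m S (soloBlindExactFam h B x τ) true = true) :
    soloBlindMass h (B ∪ Finset.univ.map x) τ ≤ 1 / 2 := by
  have e := soloBlind_typeModel hli hdist x hxB τ true S zsf (fun _ => hgood) hcheck
  simp only [if_true] at e
  push_cast at e
  have h2 : (2 : ℚ) ^ S = 2 * 2 ^ (S - 1) := by rw [← pow_succ', Nat.sub_add_cancel hS]
  rw [h2, ← mul_assoc] at e
  have e2 : soloBlindMass h (B ∪ Finset.univ.map x) τ * 2 ≤ 1 :=
    le_of_mul_le_mul_right (by rwa [one_mul]) (pow_pos two_pos (S - 1))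
  linarith

end Model

end Summit.MatrixMultiplication.MatrixMultiplication.Theorems
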